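import Summits.QuantumAdvantage.QuantumAdvantage.Theorems.SparsityDialCounterSplitGlue

/-! # AbelianDialA — part 1/5 of the landing twins of NODE «AbelianDial» (decomp-qadv lens-2; node file
`g23/AbelianDial.lean`, sha256 4845a3792d6530ec…; generator `g23/tree/gen_twins.py`: namespace
`Theses.AbelianDial` → `Theorems.AbelianDial`, cut at declaration boundaries, docstrings added where missing, nothing else).
Content: §1 THE DIAL (`alin`, `TableForm`, `StabTable`, the pieces `AbelianLoss3` / `NonAbelianLoss3`, `closes` BY NAME onto
`Theses.SparsityDial.NonCounterGenericLoss3` = stmt-QuantumAdvantage-27009 through the tree junction `nonCounterGenericLoss3_iff_node`,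
`closesD`, the N-tests and `split_iff`), §2 counter form = type `(2,1)` EXACTLY (`stabCounter_iff_stabTable21`) + gauge saturation.
The node's full docstring follows. -/

/-! # AbelianDial — NODE g23 of decomp-qadv lens-2 «structural dichotomy (special vs generic)»
(RESIDUAL MODE on `route-QuantumAdvantage-SparsityDial` (DRAFT rev 2); generation 23; 0 `sorry`; imports the tree only.)

## §0  Target, node equation, tags
**TARGET (BY NAME)** = the residual OF RECORD: item B = `Summit.QuantumAdvantage.QuantumAdvantage.Theses.SparsityDial.
NonCounterGenericLoss3` (stmt-QuantumAdvantage-27009, leaf IDEA-NEEDED), `Iff.rfl`-bridged to the tree piece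
`Theorems.CounterDial.NonCounterGenericLoss3` by `Theorems.SparsityDial.nonCounterGenericLoss3_iff_node`; sibling
A = `Theses.SparsityDial.CounterLoss3` (27008), parent D = `Theses.SparsityDial.DenseGenericLoss3` (27656, glue 27010 CLOSED
by `Theorems.SparsityDial.counterSplitGlue3`).  VERBATIM B: `∃ a C, ∀ c, ∃ n₀, ∀ n ≥ n₀, ∀ P` of degree `≤ (log₂ n)^c`,
`¬ StabFew ((log₂ n)^a) 0 (c+1) P → ¬ StabCounter (c+1) P → #{odd x winning} ≤ (1 − n^{-C}) 2^{n−1}`.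

**NODE EQUATION:**  `B ⟸ AbelianLoss3 ∧ NonAbelianLoss3` — `closes : AbelianLoss3 → NonAbelianLoss3 → B` (§1, by name,
through the junction), `closesD : A → AbelianLoss3 → NonAbelianLoss3 → D` (through the landed glue), and the split is
EXACT: `split_iff : B ↔ AbelianLoss3 ∧ NonAbelianLoss3` (`abelian_of_B`, `nonAbelian_of_B` are restrictions).
A GENUINE PARTITION node (like g21 «CounterDial»: a new invariant cuts B's hypothesis class in two, each piece strictly
weaker, jointly equivalent), not a law-node costume: neither piece is equivalent to B by a theorem of this file.

* `AbelianLoss3` (S, SPECIAL) — **WEAKER** (`B → S` = `abelian_of_B`; `S → B` must-fail, bc/Probe F6) · **OPEN** ·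
  **ATTACKABLE** (in-measure orbit laws): three DECIDED sub-rungs here — §3 every GAPPED table loses (`gappedTableLoss`,
  tree dark-window law), §3b the whole TYPE `(1,1)` (PARITY tables) loses (`abelianLoss3_one_one` = the `(1,1)`-instance
  of S, tree additive-response law) and ★ §6 the parity-mixed TWIN family loses (`PmLoss3`, a NEW law); the class is
  inhabited by a certified non-counter-form member (§5: `pm_stabTable`, `pm_not_counterForm_zero`, `pm_in_dense_class`).
  Open core of S = ODD-MODULUS position-DIVERSE tables (Paley-type twins; character sums), shared in spirit with A.
* `NonAbelianLoss3` (G, GENERIC = the re-typed RESIDUAL) — **WEAKER** (`B → G` = `nonAbelian_of_B`; `G → B` must-fail F7)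
  · **OPEN** · **IDEA-NEEDED / BARRIER-adjacent** (`Literature.Barriers.QuantumAdvantage.TwoModuliDepthTwo`: quadratic and
  higher phases mod 3 against parity are exactly the regime no Smolensky/VW-type bound in the tree reaches; for degree
  `≥ log n` also `NonclassicalDegreeLogBarrier`) · inhabited WITH CERTIFICATE FOR EVERY TYPE: the quadratic MATCHING family
  `qStrat` (§4: `q_not_tableForm_zero : ∀ m r, ∀ n ≥ 2(m+1)^r+4, ¬ (m,r)-table-form at the zero gauge`, by PIGEONHOLE;
  `q_in_dense_class`; `q_not_counterForm_zero`) · UNDECIDED (no loss theorem for `qStrat`: F17 must-fail).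

## The dial (new on the lineage V1–V22 and on the bus): the BOUNDED ABELIAN TYPE of the deviation field
After a cheap gauge (padding by stabilizer rows of degree `≤ (log n)^e`, the format of `StabFew`/`StabCounter`), position
`k` deviates from the canonical guess at the odd input `x` iff a Boolean TABLE `G k` accepts the ABELIAN READOUT
`alin m r (v k) x = (Σ_i v_{k,i,j} x_i)_{j<r} ∈ (Z_{m+1})^r` — the gate factors through a bounded abelian quotient of the
input lattice (`TableForm m r`, `StabTable m r e`).  Type `(2,1)` = COUNTER FORM EXACTLY (`stabCounter_iff_stabTable21`,
§2: g21's dial is the rank-one slice of this one, so B's hypothesis `¬ StabCounter` reads `¬ StabTable 2 1`); monotone in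
the rank (`tableForm_mono_rank`); GAUGE-SATURATED (`stabTable_of_stabTable_pad` / `stabTable_pad_of_stabTable`, §2 — the
padding test that killed g16's zero-gauge classes passes).  OBSERVATION (memo §2-group; Lean bridge deferred to g24, it
needs g22's `EchoDialC` in the tree): for a 2-GROUP type (`m + 1 = 2^j`) the readout along a pair-flip orbit is
`Z_{2^j}`-affine in the flags, so every position's echo has `𝔽₂`-degree `≤ r·(2^j − 1)` at EVERY odd input and EVERY
placement — such fields are cheaply echo-structured and S restricted to 2-group types follows from g22's `echoLoss3`;
the OPEN core of S is the ODD-MODULUS types beyond rank-one `Z₃` (smallest: `(2,2)`, whose twin sub-family §6 decides;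
`(4,1)` = one `Z₅`-form).  The
special piece quantifies `∀ (m, r)` (constants may depend on the type), the generic piece `∃ (m, r)`: exhaustion is then
trivial (`closesB`: take the generic witness type, split B's class by `StabTable m r (c+1) P`) and no polylog RANK bound
is ever needed (dead end: log-rank thresholds would ask for EGZ/Davenport-type rank lower bounds on the generic side).
The axis is the ALGEBRAIC TYPE of the gate's dependence on the input — linear phases over a bounded abelian group
(bottom fan-in `1`: the print-decided `d = 1` side of the Constant Degree Hypothesis, [BarringtonStraubingTherien1990],
[GrolmuszTardos2000], [KawalekWeiss2023] as recorded in `Literature.Barriers.QuantumAdvantage.TwoModuliDepthTwo`) versus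
quadratic-or-higher readouts (CDH `d ≥ 2`, open; print engine for `d = 2` vs parity: F. Green, JCSS 69 (2004)) — skew BY CONSTRUCTION to g21 (one `Z₃`-form, level sets), g22 (`𝔽₂`-degree of the ECHO in
the flip variables), lens-3 (`𝔽₃`-degree of the strategy), lens-1 (light cones / juntas), g ≤ 20 (holonomy, stabilizer
sparsity, blindness): `apStrat`/counters are type `(2,1)`, the twin family is `(2,2)` and not `(2,1)`, `qStrat` has NO
bounded type, `e₃`/`Z₉`-window readers ARE abelian (type `(8,1)`) — recorded so nobody files them as generic.

## Certificates (all at the ZERO gauge, as g21/g22; all-gauge negations are must-fail F13/F14 = honest scope)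
§4 `q_sep`/`q_not_tableForm`: at position `N−1` the `⌊(N−1)/2⌋` partner columns `v_{N−1}(qcell t) ∈ (Z_{m+1})^r` collide
once `(m+1)^r < ⌊(N−1)/2⌋` (`Fintype.exists_ne_map_eq_of_card_lt`); the inputs `{pcell t, qcell t'} ∪ C` and
`{pcell t, qcell t} ∪ C` (`C ⊆ {cell 0}` fixes the parity) then have equal readouts and matching counts `0 ≠ 1` — a
COLLISION argument: no character sum, no rank bound, every type at once.  §5(b) `pm_not_counterForm`: pigeonhole gives
five odd cells with a common coefficient `α` and five even cells with `β`; on inputs supported there the form reads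
`p·α + q·β`, the parity constraint fixes `p + q (mod 2)`, and the `9·16`-case core `pm_core` (`decide`) separates
`[p ≡ 0] ⊕ [q ≡ 0]` from every `[p·α + q·β ∈ A]`.  RECORDED FAILURE: the first core on FIVE LOCAL cells was REFUTED by
`decide` — under the parity constraint the twin gate coincides there with `[Σ_odd − Σ_even ≢ 0]` (a genuine level set);
ten pigeonholed cells are needed.

## ★ The TWIN COINCIDENCE LAW (§6) — rung currency
`pmLoss : n ≥ 2¹⁵ → #{odd winners of the twin family} ≤ (1 − n⁻¹)·2^{n−1}`, `PmLoss3` in B's format (`C = 1`).  On a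
COINCIDENCE input (equal bits on the five site pairs `{20+4i, 21+4i}`, `Σ_odd ≡ Σ_even`) every pair-flip moves both
counters equally (`lodd_orbF` tree, `leven_orbF` here), so the twin gate stays dark on the whole 32-orbit and the pointer
positions are untouched: `pm_addResp : Coin x → AddResp bS pm (fun _ => ∅) x`, hence (tree `additive_loss_count`)
`#{odd ∧ Coin} ≤ 32·#losers`; the fix-up `cfix` (copy each site bit to its odd neighbour, set five odd adjuster cells by a
mod-6 CRT count `sfix`) maps every input to an odd coincidence input touching 10 cells (`cfix_odd`, `cfix_coin`, tree
`fibre_le_pow`) ⇒ `#odd ≤ 2¹⁵·#losers` (`pm_loss_count`) ⇒ `real_loss_of_frac`.  This DECIDES the lineage's standing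
«twin-XOR» exemplar (NODE-g22 IDEA-NEEDED list; crit-1 69v54's K-test) — it LOSES — by a law outside the echo/blind
engines (no certificate search, no window rotation).

## Why each piece is strictly weaker, and what is not claimed
`B → S`, `B → G` are restrictions (proved); `S ↛ B`, `G ↛ B`, `S ∧ A ↛ D` without G, `⊬ S`, `⊬ G`, `⊬ ¬S`, `⊬ ¬G` are the
must-fail probes F4–F11 of `bc/Probe.lean` (all fail as expected; see `bc/VERDICTS.txt`).  S is not vacuous (twin family
inhabits its class and is NOT counter-form) and not trivial (its open core contains position-diverse tables); G is not
vacuous (`qStrat`, certified for every type).  NOT CLAIMED: any loss theorem for `qStrat` or for general tables; all-gauge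
non-table-form; anything about A.  No ledger items are filed by this node (NODE OUTPUT CONTRACT: node file + memo + bus).

## File map
§1 dial, pieces, `closes`/`closesD`, N-tests, `split_iff` · §2 counter form = type `(2,1)` (`stabCounter_iff_stabTable21`),
gauge saturation, rank monotonicity · §3 decided sub-rung: gapped tables (`gappedTableLoss`) · §3b decided sub-rung: type `(1,1)` = parity
tables (`parity_addResp`, `parityTableLoss`, `abelianLoss3_one_one`) · §4 generic inhabitant `qStrat` + pigeonhole
certificate (`q_not_tableForm_zero`, `q_not_counterForm_zero`, `q_in_dense_class`) · §5 special inhabitant `pmStrat`: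
`(2,2)`-table-form (`pm_stabTable`), dense, not counter-form (`pm_core`, `pm_not_counterForm_zero`) · §6 ★ twin
coincidence law (`leven_orbF`, `pm_addResp`, `coin_loss_count`, `cfix`, `univ_le_coin`, `pm_loss_count`, `pmLoss`, `PmLoss3`).
Dead ends (memo `NODE-g23.md` §Dropped): junk-padding costume; zero-gauge classes; log-rank thresholds; `e₃`/`Z₉` readers
as generic; single global quadratic gate (dark in measure); abelian ⊕ quadratic gate; global twins as the open core
(decided here instead); `skStrat`; shifted-move blind law (engine re-run); overlapping dark windows for the twin law.
-/

set_option linter.dupNamespace false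
noncomputable section
open scoped Classical

namespace Summit.QuantumAdvantage.QuantumAdvantage.Theorems.AbelianDial
open Finset
open Literature.Computability.QuantumComplexity Literature.Computability.QuantumComplexity.RingHLF
open Literature.Computability.MetaComplexity Literature.Computability.MetaComplexity.Smolensky
open Summit.QuantumAdvantage.AdviceFreeQNC0
open Summit.QuantumAdvantage.QuantumAdvantage.Theorems.AnchorDial (outB dev orbF oddZeros_orbF orbF_apply_of_far
  card_filter_orbF card_odd_ge loss_shape_mono)
open Summit.QuantumAdvantage.QuantumAdvantage.Theorems.HolonomyDial (tPoly tPoly_apply tPoly_mem xorP xorP_mem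
  xorP_apply_bool indP indP_apply indP_mem mono_singleton_apply)
open Summit.QuantumAdvantage.QuantumAdvantage.Theorems.StabilizerDial (apIdx apStrat apStrat_mem bitP bitP_apStrat pad
  pad_mem rel_pad_iff StabFew outB_pad_pad outB_pad_congr bitP_gsum gsum gsum_mem deg_gsum dev_congr)
open Summit.QuantumAdvantage.QuantumAdvantage.Theorems.SparsityDial (real_loss_of_frac stabFew_mono_mr one_le_logpow)
open Summit.QuantumAdvantage.QuantumAdvantage.Theorems.ResponseDial (mem_dev_apStrat dev_pad_zero
  not_polylogSparse_of_agree AddResp additive_loss_count lodd lodd_mem lodd_eq_sum lodd_orbF oddSite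
  oddSite_val oddSite_odd card_exists_orbF_le fibre_le_pow orbF_apply)
open Summit.QuantumAdvantage.QuantumAdvantage.Theorems.CounterDial (bsel mem_iff_bsel)
open Summit.QuantumAdvantage.QuantumAdvantage.Theorems.CounterDial (lin CounterForm StabCounter Dark dw dw_apply_of_far
  oddZeros_dw dark_loss_count)
open Summit.QuantumAdvantage.QuantumAdvantage.Theorems.BlindDial (apIdx_val_first)

variable {N : ℕ}

/-! ## §1  THE DIAL: bounded abelian table form (special) versus not (generic residual) -/

/-- the ABELIAN READOUT of the input by `r` linear forms modulo `m+1` with coefficient table `v`: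
`x ↦ (Σ_i v_{i,j} x_i)_{j<r} ∈ (Z_{m+1})^r` — the image of `x` under a homomorphism `Z^N → (Z_{m+1})^r`. -/
def alin (m r : ℕ) (v : Fin N → Fin r → ZMod (m + 1)) (x : Fin N → Bool) : Fin r → ZMod (m + 1) :=
  fun j => ∑ i, if x i then v i j else 0

/-- TABLE FORM `(m, r)`: at every odd input, position `k` deviates from the canonical guess iff the Boolean table `G k`
accepts the abelian readout `alin m r (v k)` — every deviation gate FACTORS THROUGH A BOUNDED ABELIAN QUOTIENT
`(Z_{m+1})^r` of the input lattice ("linear phases": the print-solved side `MOD_q ∘ MOD_{m+1}`). Counter form is the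
case `(m, r) = (2, 1)` (§2). -/
def TableForm (m r : ℕ) (v : Fin N → Fin N → Fin r → ZMod (m + 1)) (G : Fin N → (Fin r → ZMod (m + 1)) → Bool)
    (Q : Fin N → CubeFn (ZMod 3) N) : Prop :=
  ∀ x : Fin N → Bool, OddZeros x → ∀ k : Fin N, k ∈ dev Q x ↔ G k (alin m r (v k) x) = true

/-- CHEAPLY `(m, r)`-TABLE-FORM: after padding by stabilizer rows selected by polynomials of degree `≤ (log N)^e` (the
gauge of `StabFew` / `StabCounter`, same format) the field is in table form `(m, r)` — a gauge-SATURATED predicate (§2). -/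
def StabTable (m r e : ℕ) (P : Fin N → CubeFn (ZMod 3) N) : Prop :=
  ∃ s : Fin N → CubeFn (ZMod 3) N, (∀ i, s i ∈ lowDeg (ZMod 3) N ((Nat.log 2 N) ^ e)) ∧
    ∃ (v : Fin N → Fin N → Fin r → ZMod (m + 1)) (G : Fin N → (Fin r → ZMod (m + 1)) → Bool),
      TableForm m r v G (pad P s)

/-- **B_ab — the SPECIAL piece `AbelianLoss3`**: for EVERY bounded abelian type `(m, r)`: dense, not cheaply counter-form,
but cheaply `(m, r)`-table-form ⟹ polynomial loss (exponents `a, C` may depend on `(m, r)`). -/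
def AbelianLoss3 : Prop :=
  ∀ m r : ℕ, ∃ a : ℕ, ∃ C : ℕ, ∀ c : ℕ, ∃ n₀ : ℕ, ∀ n ≥ n₀, ∀ P : Fin n → CubeFn (ZMod 3) n,
    (∀ i, P i ∈ lowDeg (ZMod 3) n ((Nat.log 2 n) ^ c)) →
      ¬ StabFew ((Nat.log 2 n) ^ a) 0 (c + 1) P → ¬ StabCounter (c + 1) P → StabTable m r (c + 1) P →
        ((univ.filter fun x : Fin n → Bool =>
            OddZeros x ∧ Rel x (fun i => decide (P i x = 1))).card : ℝ)
          ≤ (1 - 1 / (n : ℝ) ^ C) * (2 : ℝ) ^ (n - 1)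

/-- **B_nonab — the GENERIC piece (RESIDUAL) `NonAbelianLoss3`**: for SOME bounded abelian type `(m, r)`: dense, not
cheaply counter-form and NOT cheaply `(m, r)`-table-form ⟹ polynomial loss. -/
def NonAbelianLoss3 : Prop :=
  ∃ m r : ℕ, ∃ a : ℕ, ∃ C : ℕ, ∀ c : ℕ, ∃ n₀ : ℕ, ∀ n ≥ n₀, ∀ P : Fin n → CubeFn (ZMod 3) n,
    (∀ i, P i ∈ lowDeg (ZMod 3) n ((Nat.log 2 n) ^ c)) →
      ¬ StabFew ((Nat.log 2 n) ^ a) 0 (c + 1) P → ¬ StabCounter (c + 1) P → ¬ StabTable m r (c + 1) P →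
        ((univ.filter fun x : Fin n → Bool =>
            OddZeros x ∧ Rel x (fun i => decide (P i x = 1))).card : ℝ)
          ≤ (1 - 1 / (n : ℝ) ^ C) * (2 : ℝ) ^ (n - 1)

/-- **`closesB`: B_ab → B_nonab → B** onto the tree-side copy `Theorems.CounterDial.NonCounterGenericLoss3`
(pick the `(m, r)` of the generic piece, instantiate the special piece there, `a, C, n₀ := max`, cases on
`StabTable m r (c+1) P`). -/
theorem closesB (hS : AbelianLoss3) (hG : NonAbelianLoss3) :
    Summit.QuantumAdvantage.QuantumAdvantage.Theorems.CounterDial.NonCounterGenericLoss3 := by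
  obtain ⟨m, r, a₂, C₂, h₂⟩ := hG
  obtain ⟨a₁, C₁, h₁⟩ := hS m r
  refine ⟨max a₁ a₂, max C₁ C₂, fun c => ?_⟩
  obtain ⟨n₁, hn₁⟩ := h₁ c
  obtain ⟨n₂, hn₂⟩ := h₂ c
  refine ⟨max (max n₁ n₂) 2, fun n hn P hP hgen hnc => ?_⟩
  have hn2 : 2 ≤ n := le_trans (le_max_right _ _) hn
  have hn12 : max n₁ n₂ ≤ n := le_trans (le_max_left _ _) hn
  have hL : 1 ≤ Nat.log 2 n := Nat.le_log_of_pow_le (by norm_num) (by simpa using hn2)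
  have hg₁ : ¬ StabFew ((Nat.log 2 n) ^ a₁) 0 (c + 1) P := fun h =>
    hgen (stabFew_mono_mr (Nat.pow_le_pow_right hL (le_max_left _ _)) (one_le_logpow hn2 a₁) le_rfl h)
  have hg₂ : ¬ StabFew ((Nat.log 2 n) ^ a₂) 0 (c + 1) P := fun h =>
    hgen (stabFew_mono_mr (Nat.pow_le_pow_right hL (le_max_right _ _)) (one_le_logpow hn2 a₂) le_rfl h)
  by_cases ht : StabTable m r (c + 1) P
  · exact loss_shape_mono (by omega) (le_max_left _ _) _ _ (by positivity)
      (hn₁ n (le_trans (le_max_left _ _) hn12) P hP hg₁ hnc ht)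
  · exact loss_shape_mono (by omega) (le_max_right _ _) _ _ (by positivity)
      (hn₂ n (le_trans (le_max_right _ _) hn12) P hP hg₂ hnc ht)

/-- **`closes` — THE NODE'S DECIDING THEOREM, onto item B BY NAME**:
`AbelianLoss3 → NonAbelianLoss3 → Theses.SparsityDial.NonCounterGenericLoss3` (through the tree's `Iff.rfl` junction
`Theorems.SparsityDial.nonCounterGenericLoss3_iff_node`). -/
theorem closes (hS : AbelianLoss3) (hG : NonAbelianLoss3) :
    Summit.QuantumAdvantage.QuantumAdvantage.Theses.SparsityDial.NonCounterGenericLoss3 :=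
  Summit.QuantumAdvantage.QuantumAdvantage.Theorems.SparsityDial.nonCounterGenericLoss3_iff_node.2 (closesB hS hG)

/-- the node composed with the sibling A and the CLOSED junction of the parent split: `A → B_ab → B_nonab → D`
(items `Theses.SparsityDial.CounterLoss3` 27008 and `Theses.SparsityDial.DenseGenericLoss3` 27656, via the landed
`Theorems.SparsityDial.counterSplitGlue3`). -/
theorem closesD (hA : Summit.QuantumAdvantage.QuantumAdvantage.Theses.SparsityDial.CounterLoss3) (hS : AbelianLoss3)
    (hG : NonAbelianLoss3) : Summit.QuantumAdvantage.QuantumAdvantage.Theses.SparsityDial.DenseGenericLoss3 :=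
  Summit.QuantumAdvantage.QuantumAdvantage.Theorems.SparsityDial.counterSplitGlue3 hA (closes hS hG)

/-- N-test, special piece: `B → AbelianLoss3` (restriction; the same `a, C` serve every `(m, r)`). -/
theorem abelian_of_B (hB : Summit.QuantumAdvantage.QuantumAdvantage.Theses.SparsityDial.NonCounterGenericLoss3) :
    AbelianLoss3 := by
  obtain ⟨a, C, h⟩ := Summit.QuantumAdvantage.QuantumAdvantage.Theorems.SparsityDial.nonCounterGenericLoss3_iff_node.1 hB
  refine fun m r => ⟨a, C, fun c => ?_⟩
  obtain ⟨n₀, hn₀⟩ := h c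
  exact ⟨n₀, fun n hn P hP hgen hnc _ => hn₀ n hn P hP hgen hnc⟩

/-- N-test, generic piece: `B → NonAbelianLoss3` (restriction, at `(m, r) = (0, 0)` say). -/
theorem nonAbelian_of_B (hB : Summit.QuantumAdvantage.QuantumAdvantage.Theses.SparsityDial.NonCounterGenericLoss3) :
    NonAbelianLoss3 := by
  obtain ⟨a, C, h⟩ := Summit.QuantumAdvantage.QuantumAdvantage.Theorems.SparsityDial.nonCounterGenericLoss3_iff_node.1 hB
  refine ⟨0, 0, a, C, fun c => ?_⟩
  obtain ⟨n₀, hn₀⟩ := h c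
  exact ⟨n₀, fun n hn P hP hgen hnc _ => hn₀ n hn P hP hgen hnc⟩

/-- EXACTNESS of the split: `B ↔ AbelianLoss3 ∧ NonAbelianLoss3` (no strength is lost at the junction). -/
theorem split_iff : Summit.QuantumAdvantage.QuantumAdvantage.Theses.SparsityDial.NonCounterGenericLoss3 ↔
    (AbelianLoss3 ∧ NonAbelianLoss3) :=
  ⟨fun h => ⟨abelian_of_B h, nonAbelian_of_B h⟩, fun h => closes h.1 h.2⟩

/-! ## §2  Counter form = type `(2,1)`; SATURATION under the gauge (the padding test); rank monotonicity -/

/-- counter form IS table form of type `(2, 1)`: one `Z₃`-linear form, table = membership of its value in `A k`. -/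
theorem tableForm_of_counterForm {a : Fin N → Fin N → ZMod 3} {A : Fin N → Finset (ZMod 3)}
    {Q : Fin N → CubeFn (ZMod 3) N} (h : CounterForm a A Q) :
    TableForm 2 1 (fun k i _ => a k i) (fun k w => decide (w 0 ∈ A k)) Q := by
  intro x hx k
  rw [h x hx k, decide_eq_true_iff]
  exact Iff.rfl

/-- hence cheaply counter-form ⟹ cheaply `(2, 1)`-table-form (same gauge): the abelian dial EXTENDS the counter dial. -/
theorem stabTable_of_stabCounter {e : ℕ} {P : Fin N → CubeFn (ZMod 3) N} (h : StabCounter e P) : StabTable 2 1 e P := by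
  obtain ⟨s, hs, a, A, hF⟩ := h
  exact ⟨s, hs, _, _, tableForm_of_counterForm hF⟩

/-- conversely a RANK-ONE `Z₃` table IS a counter form: read the single readout coordinate, take the accepted residues as
the level set.  So counter form is EXACTLY the type `(2, 1)` of the abelian dial. -/
theorem counterForm_of_tableForm21 {v : Fin N → Fin N → Fin 1 → ZMod 3} {G : Fin N → (Fin 1 → ZMod 3) → Bool}
    {Q : Fin N → CubeFn (ZMod 3) N} (h : TableForm 2 1 v G Q) :
    CounterForm (fun k i => v k i 0) (fun k => univ.filter fun t : ZMod 3 => G k (fun _ => t) = true) Q := by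
  intro x hx k
  have e : alin 2 1 (v k) x = fun _ => lin (fun i => v k i 0) x := by
    funext j
    rw [Fin.eq_zero j]
    unfold alin lin
    rfl
  rw [h x hx k, e, mem_filter]
  simp

/-- hence cheaply `(2, 1)`-table-form ⟹ cheaply counter-form (same gauge). -/
theorem stabCounter_of_stabTable21 {e : ℕ} {P : Fin N → CubeFn (ZMod 3) N} (h : StabTable 2 1 e P) : StabCounter e P := by
  obtain ⟨s, hs, v, G, hT⟩ := h
  exact ⟨s, hs, _, _, counterForm_of_tableForm21 hT⟩

/-- **counter form = abelian type `(2, 1)`**: `StabCounter e P ↔ StabTable 2 1 e P` (g21's dial is the rank-one slice of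
this one; in particular the hypothesis `¬ StabCounter` of B is `¬ StabTable 2 1`). -/
theorem stabCounter_iff_stabTable21 {e : ℕ} {P : Fin N → CubeFn (ZMod 3) N} : StabCounter e P ↔ StabTable 2 1 e P :=
  ⟨stabTable_of_stabCounter, stabCounter_of_stabTable21⟩

/-- ROW-PADDING TEST, direction 1: a strategy one of whose cheap pads is cheaply table-form is itself cheaply table-form
(one notch up) — `StabTable m r` is SATURATED under the gauge, so neither piece is `≡ B` by padding. -/
theorem stabTable_of_stabTable_pad (hN : 16 ≤ N) {m r e₀ e : ℕ} (he : e₀ ≤ e) {P s₀ : Fin N → CubeFn (ZMod 3) N}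
    (hs₀ : ∀ i, s₀ i ∈ lowDeg (ZMod 3) N ((Nat.log 2 N) ^ e₀)) (h : StabTable m r e (pad P s₀)) :
    StabTable m r (e + 1) P := by
  obtain ⟨s, hs, v, G, hF⟩ := h
  refine ⟨gsum s₀ s, fun i => lowDeg_mono (deg_gsum hN he) (gsum_mem hs₀ hs i), v, G, fun x hx k => ?_⟩
  rw [← dev_congr (fun x => outB_pad_pad P s₀ s x) x]
  exact hF x hx k

/-- ROW-PADDING TEST, direction 2: padding a cheaply table-form strategy keeps it cheaply table-form. -/
theorem stabTable_pad_of_stabTable (hN : 16 ≤ N) {m r e₀ e : ℕ} (he : e₀ ≤ e) {P s₀ : Fin N → CubeFn (ZMod 3) N}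
    (hs₀ : ∀ i, s₀ i ∈ lowDeg (ZMod 3) N ((Nat.log 2 N) ^ e₀)) (h : StabTable m r e P) :
    StabTable m r (e + 1) (pad P s₀) := by
  obtain ⟨s, hs, v, G, hF⟩ := h
  refine ⟨gsum s₀ s, fun i => lowDeg_mono (deg_gsum hN he) (gsum_mem hs₀ hs i), v, G, fun x hx k => ?_⟩
  have e1 : ∀ x, outB (pad (pad P s₀) (gsum s₀ s)) x = outB (pad P s) x := fun x => by
    rw [outB_pad_pad]
    exact outB_pad_congr (fun i x => by
      rw [bitP_gsum, bitP_gsum, ← Bool.xor_assoc, Bool.xor_self, Bool.false_xor]) P x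
  rw [dev_congr e1 x]
  exact hF x hx k

/-- monotonicity of the table type: a table of type `(m, r)` is a table of type `(m, r')` for `r ≤ r'` (pad the readout
with unused coordinates). -/
theorem tableForm_mono_rank {m r r' : ℕ} (hr : r ≤ r') {v : Fin N → Fin N → Fin r → ZMod (m + 1)}
    {G : Fin N → (Fin r → ZMod (m + 1)) → Bool} {Q : Fin N → CubeFn (ZMod 3) N} (h : TableForm m r v G Q) :
    TableForm m r' (fun k i j => if hj : j.val < r then v k i ⟨j.val, hj⟩ else 0)
      (fun k w => G k (fun j => w (Fin.castLE hr j))) Q := by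
  intro x hx k
  rw [h x hx k]
  have e : (fun j : Fin r => alin m r' (fun i j => if hj : j.val < r then v k i ⟨j.val, hj⟩ else 0) x
      (Fin.castLE hr j)) = alin m r (v k) x := by
    funext j
    unfold alin
    refine sum_congr rfl fun i _ => ?_
    beta_reduce
    rw [dif_pos (show (Fin.castLE hr j).val < r from j.isLt)]
    rfl
  exact (iff_of_eq (congrArg (fun w => G k w = true) e)).symm

end Summit.QuantumAdvantage.QuantumAdvantage.Theorems.AbelianDial
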